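import Literature.Computability.QuantumComplexity.CubicForrelationEstimatorAnalysis
import Literature.Computability.QuantumComplexity.ForrelationIdleWires
import Literature.Computability.Complexity.TM2PassThrough

/-!
# `CubicForrelationInPrBPP` — negative knowledge: the idle-wire guard is an even-`k` device

Support file for crux `stmt-QuantumAdvantage-2204`
(`Summit.QuantumAdvantage.QuantumAdvantage.Theses.CubicForrelation.CubicForrelationInPrBPP` =
`cubicKForrelationProblem 2 ∈ PromiseBPP'`, closed in Literature by
`CubicDequant.cubicKForrelationProblem_two_mem_PromiseBPP'`), written by the deep refuter
refuter-drefute-stmt-QuantumAdvantage-2204-g2-0 (2026-08-16) as the hypothesis-mutation record of the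
registered stub `stub_idleWireGuard` of the line `pauli-fidelity-sampling`
(`∀ I, I.k = 2 → I.IsYes → I.n ≤ |encode I| + 1`, tree `CubicDequant.guard_of_isYes`).

The instance code writes `n` in binary, so a decider polynomial in `|code|` cannot afford to touch
all `n` wires; at `k = 2` this is harmless because every idle wire multiplies `Φ` by `2^{-1/2}`
(`idleFactor_of_even`), so a YES instance has at most one idle wire. **The hypothesis `k = 2` (more
precisely: `k` even) is load-bearing**: for odd `k` idle wires leave `Φ` unchanged
(`kForrelationValue_idle_pow_of_odd`), and the all-constant instance on `2^{k+10}` wires is a YES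
instance (`Φ = 1`) with a code of length `2(k + 11) + 2|bin k| + 48k + 4 < 2^{k+10}`:

* `constFalseCircuit n` (one arity-`0` gate), `constTuple k t` (`k` constant circuits on `t` wires),
  `constTuple_value` (`Φ = 1` for odd `k`), `constTuple_encode_length` (exact code length);
* `idleWireGuard_false_of_odd`: for every odd `k` the guard statement with `I.k = 2` replaced by
  `I.k = k` is FALSE; corollaries `idleWireGuard_false_at_k3` (the route's tenure rung) and
  `idleWireGuard_false_at_k1`;
* `idleWireGuard_of_even`: for every EVEN `k` it holds (the tree proof of `guard_of_isYes` verbatim);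
* `idleWireGuard_iff_even`: the parity dichotomy — for fixed `k`, the guard holds iff `k` is even.

Consequence for the `k = 3` restatement: a `k = 3` decider gets no help from a length guard and must
instead be oblivious to idle wires (which is consistent, since they do not affect `Φ` there).

## References

* [AaronsonAmbainis2018] S. Aaronson, A. Ambainis, Forrelation, SIAM J. Comput. 47 (2018), §1.1.3, §3.2, §6.
-/

noncomputable section

set_option linter.dupNamespace false -- D-0017: single-problem summit ⇒ `QuantumAdvantage.QuantumAdvantage` by design

namespace Summit.QuantumAdvantage.QuantumAdvantage.Theorems.CubicForrelationInPrBPP.Negative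

open Finset
open Computability Literature.Computability.Complexity Literature.Computability.QuantumComplexity

/-! ### Constant circuits and all-constant instances -/

/-- The one-gate `B₂`-circuit computing the constant `false` (a single arity-`0` gate). [folklore] -/
def constFalseCircuit (n : ℕ) : Circuit (Fin n) where
  gates := [⟨0, fun _ => false, Fin.elim0⟩]
  output := .inr 0
  wf := by
    intro j hj a m _
    simp only [List.length_singleton] at hj
    have hj0 : j = 0 := by omega
    subst hj0
    exact a.elim0
  wf_output := by
    intro m hm
    simp only [Sum.inr.injEq] at hm
    subst hm
    simp

/-- `constFalseCircuit` computes the constant `false`. [folklore] -/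
@[simp] theorem constFalseCircuit_eval (n : ℕ) (x : Fin n → Bool) : (constFalseCircuit n).eval x = false := by
  simp [Circuit.eval, Circuit.wireVals, constFalseCircuit]

/-- `constFalseCircuit` is over `B₂` (fan-in `0 ≤ 2`). [folklore] -/
theorem constFalseCircuit_isOver (n : ℕ) : (constFalseCircuit n).IsOver B2 := by
  intro g hg
  simp only [constFalseCircuit, List.mem_singleton] at hg
  subst hg
  show (0 : ℕ) ≤ 2
  omega

/-- The code of `constFalseCircuit n` has length `23` (independently of `n`). [folklore] -/
theorem length_encodeCircuit_constFalseCircuit (n : ℕ) :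
    (encodeCircuit (constFalseCircuit n)).length = 23 := by
  have h0 : encodeNat 0 = [] := by decide
  simp [encodeCircuit, encodeGate, encodeWire, constFalseCircuit, encodeCodeList, h0]

/-- The `k`-fold forrelation of `k` constants on zero wires is `1`, for every `k`.
[cite: AaronsonAmbainis2018, §1.1.3] -/
theorem kForrelationValue_const_zero (k : ℕ) :
    kForrelationValue (n := 0) (k := k) (fun _ _ => false) = 1 := by
  unfold kForrelationValue
  simp [signOf, twist]

/-- `k` constant circuits on `t` wires (arity written `0 + t` to match the idle-wire lemma).
[cite: AaronsonAmbainis2018, §6] -/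
def constTuple (k t : ℕ) : KForrelationInstance := ⟨0 + t, k, fun _ => constFalseCircuit (0 + t)⟩

/-- **`Φ(constTuple k t) = 1` for odd `k` and every `t`**: at odd `k` idle wires are free
(`kForrelationValue_idle_pow_of_odd`). [cite: AaronsonAmbainis2018, §3.2] -/
theorem constTuple_value {k : ℕ} (hk : k % 2 = 1) (t : ℕ) : (constTuple k t).value = 1 := by
  have h := kForrelationValue_idle_pow_of_odd (k := k) (s := 0) hk (fun _ _ => false) t
  rw [kForrelationValue_const_zero] at h
  have e : (fun i => ((constTuple k t).C i).eval) = fun (_ : Fin k) (_ : Fin (0 + t) → Bool) => false := by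
    funext i x
    exact constFalseCircuit_eval _ _
  show kForrelationValue (fun i => ((constTuple k t).C i).eval) = 1
  rw [e]
  exact h

/-- `constTuple k t` is a YES instance for odd `k` (`B₂`-circuits, `Φ = 1 ≥ 3/5`).
[cite: AaronsonAmbainis2018, §1.1.3] -/
theorem constTuple_isYes {k : ℕ} (hk : k % 2 = 1) (t : ℕ) : (constTuple k t).IsYes :=
  ⟨fun _ => constFalseCircuit_isOver _, by rw [constTuple_value hk]; norm_num⟩

/-- Length of a list code of `k` copies of one word: `k · (2|c| + 2)`. [folklore] -/
theorem length_encodeCodeList_replicate (c : List Bool) : ∀ k : ℕ,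
    (encodeCodeList (List.replicate k c)).length = k * (2 * c.length + 2)
  | 0 => by simp [encodeCodeList]
  | k + 1 => by
    have ih := length_encodeCodeList_replicate c k
    simp only [encodeCodeList, List.replicate_succ, List.foldr_cons, length_boolPair] at ih ⊢
    rw [ih]
    ring

/-- The code length of `constTuple k t` is `2|bin t| + 2|bin k| + 48k + 4`. [folklore] -/
theorem constTuple_encode_length (k t : ℕ) :
    (constTuple k t).encode.length = 2 * (encodeNat t).length + 2 * (encodeNat k).length + 48 * k + 4 := by
  show (boolPair (encodeNat (0 + t)) (boolPair (encodeNat k)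
    (encodeCodeList (List.ofFn fun _ : Fin k => encodeCircuit (constFalseCircuit (0 + t)))))).length = _
  rw [List.ofFn_const, length_boolPair, length_boolPair, length_encodeCodeList_replicate,
    length_encodeCircuit_constFalseCircuit, Nat.zero_add]
  ring

/-! ### The guard statement is false at every odd `k` -/

/-- **`stub_idleWireGuard` with `k = 2` replaced by any odd `k` is false** (the hypothesis `I.k = 2`
of `CubicDequant.guard_of_isYes` is load-bearing; what it really uses is `k` even): witness the
all-constant `k`-tuple on `2^{k+10}` wires (`Φ = 1`, code length `2(k+11) + 2|bin k| + 48k + 4`,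
but `n = 2^{k+10} ≥ 1024(k+1)`). [cite: AaronsonAmbainis2018, §3.2] -/
theorem idleWireGuard_false_of_odd {k : ℕ} (hk : k % 2 = 1) :
    ¬ ∀ I : KForrelationInstance, I.k = k → I.IsYes → I.n ≤ I.encode.length + 1 := by
  intro h
  have hI := h (constTuple k (2 ^ (k + 10))) rfl (constTuple_isYes hk _)
  rw [constTuple_encode_length, TM2Pass.length_encodeNat_eq_size, TM2Pass.length_encodeNat_eq_size,
    Nat.size_pow] at hI
  change 0 + 2 ^ (k + 10) ≤ _ at hI
  have hs : k.size ≤ k := Nat.size_le.2 Nat.lt_two_pow_self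
  have hlt : k < 2 ^ k := Nat.lt_two_pow_self
  have hpow : 2 ^ (k + 10) = 2 ^ k * 1024 := by rw [pow_add]; norm_num
  rw [hpow] at hI
  generalize 2 ^ k = P at hI hlt
  omega

/-- **The guard fails at `k = 3`** (the route's tenure rung). [cite: AaronsonAmbainis2018, §3.2] -/
theorem idleWireGuard_false_at_k3 :
    ¬ ∀ I : KForrelationInstance, I.k = 3 → I.IsYes → I.n ≤ I.encode.length + 1 :=
  idleWireGuard_false_of_odd (by decide)

/-- … and at `k = 1`. [cite: AaronsonAmbainis2018, §3.2] -/
theorem idleWireGuard_false_at_k1 :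
    ¬ ∀ I : KForrelationInstance, I.k = 1 → I.IsYes → I.n ≤ I.encode.length + 1 :=
  idleWireGuard_false_of_odd (by decide)

/-! ### … and true at every even `k`: the exact load-bearing content of `k = 2` is the parity -/

/-- **For even `k` the guard holds**: the proof of `CubicDequant.guard_of_isYes` goes through verbatim
with `I.k = 2` weakened to `I.k` even (`ForrMem.value_eq`: `Φ = Φ₀ · ρ_k^{n - #read wires}`,
`ρ_k = 2^{-1/2}` for even `k`, so two idle wires give `|Φ| ≤ 1/2 < 3/5`; `#read wires ≤ |code|` by
`ForrMem.sR_le_length`). [cite: AaronsonAmbainis2018, §3.2 and §6] -/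
theorem idleWireGuard_of_even (I : KForrelationInstance) (heven : I.k % 2 = 0) (hyes : I.IsYes) :
    I.n ≤ I.encode.length + 1 := by
  by_contra hlt
  push Not at hlt
  have hs := ForrMem.sR_le_length I
  have ht : 2 ≤ I.n - ForrMem.sR I := by omega
  have hval := ForrMem.value_eq I
  have hrho : idleFactor I.k = (Real.sqrt 2)⁻¹ := idleFactor_of_even heven
  have habs : |I.value| ≤ 1 / 2 := by
    rw [hval, abs_mul, abs_pow, hrho, abs_inv, abs_of_nonneg (Real.sqrt_nonneg 2)]
    have h1 : |ForrMem.phi0 I| ≤ 1 := abs_kForrelationValue_le_one _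
    have hr1 : (Real.sqrt 2)⁻¹ ≤ 1 := by
      rw [inv_le_one₀ (Real.sqrt_pos.2 two_pos)]
      exact Real.one_le_sqrt.2 (by norm_num)
    have hr0 : 0 ≤ (Real.sqrt 2)⁻¹ := by positivity
    have h2 : ((Real.sqrt 2)⁻¹) ^ (I.n - ForrMem.sR I) ≤ ((Real.sqrt 2)⁻¹) ^ 2 :=
      pow_le_pow_of_le_one hr0 hr1 ht
    have hsq : ((Real.sqrt 2)⁻¹) ^ 2 = 1 / 2 := by rw [inv_pow, Real.sq_sqrt (by norm_num)]; norm_num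
    calc |ForrMem.phi0 I| * (Real.sqrt 2)⁻¹ ^ (I.n - ForrMem.sR I) ≤ 1 * (1 / 2) := by
          rw [← hsq]; exact mul_le_mul h1 h2 (by positivity) zero_le_one
      _ = 1 / 2 := one_mul _
  have h35 := hyes.2
  have hle := le_abs_self I.value
  linarith

/-- **Parity dichotomy for the idle-wire guard**: for a fixed number `k` of phase layers, "every YES
instance has at most one idle wire beyond its code length" holds iff `k` is even.
[cite: AaronsonAmbainis2018, §3.2] -/
theorem idleWireGuard_iff_even (k : ℕ) :
    (∀ I : KForrelationInstance, I.k = k → I.IsYes → I.n ≤ I.encode.length + 1) ↔ k % 2 = 0 := by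
  constructor
  · intro h
    by_contra hodd
    exact idleWireGuard_false_of_odd (k := k) (by omega) h
  · intro heven I hk hyes
    exact idleWireGuard_of_even I (by rw [hk]; exact heven) hyes

end Summit.QuantumAdvantage.QuantumAdvantage.Theorems.CubicForrelationInPrBPP.Negative

end
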